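import Literature.NumberTheory.Automorphic.UnitaryGroupLevelTransport
import Literature.NumberTheory.Automorphic.UnitaryGroupFinAdelicCenter
import HarnessLib

/-!
# The frame transport `finAdelicCongr` fixes the centre of `U(J)(𝔸_f)`

Topic `NumberTheory/Automorphic`; namespace `Literature.NumberTheory.Automorphic.UnitaryGroup` (sequel of `UnitaryGroupLevelTransport`:
`finAdelicCongr F E c B ha h : U(J′)(𝔸_f) ≃* U(J)(𝔸_f)`, `g ↦ B g B⁻¹` for a rational frame `B` with `ᵗB̄ (a•J) B = J′`, and of
`UnitaryGroupFinAdelicCenter`: `finAdelicCenter F E c N J : U(1)(𝔸_{F,f}) →* U(J)(𝔸_{F,f})`, `u ↦ u·1_N`).  THEOREMS ONLY; no definition,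
no named fact, no instance, no `sorry`.

* `finAdelicCongr_finAdelicCenter` — conjugation by a rational frame sends the central element `u·1_N ∈ U(J′)(𝔸_f)` to
  `u·1_N ∈ U(J)(𝔸_f)` (scalar matrices are central);
* `finAdelicCongr_comp_finAdelicCenter` — the same as an identity of homomorphisms `U(1)(𝔸_f) → U(J)(𝔸_f)`.
Used to move statements about the centre (e.g. «the centre acts through the first factor of a see-saw pair», stated at a
diagonal frame) to an arbitrary rational frame of the same hermitian space.

## References
* [PlatonovRapinchuk1994] V. Platonov, A. Rapinchuk, *Algebraic Groups and Number Theory* (1994), §2.3 (adelic points of algebraic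
  groups; conjugation by rational elements).
* [Mok2014] C. P. Mok, Mem. AMS 235 (2015), §1 Notation p. 5 (the centre `U_{E/F}(1)` of `U_{E/F}(N)`).
-/

set_option autoImplicit false

noncomputable section

namespace Literature.NumberTheory.Automorphic.UnitaryGroup

open NumberField IsDedekindDomain

variable (F E : Type) [Field F] [NumberField F] [Field E] [NumberField E] [Algebra F E] (c : E ≃ₐ[F] E) (N : ℕ)

omit [NumberField F] in
/-- **`finAdelicCongr` fixes the centre**: `B (u·1_N) B⁻¹ = u·1_N`. [cite: PlatonovRapinchuk1994, §2.3] [cite: Mok2014, §1 Notation p. 5] -/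
theorem finAdelicCongr_finAdelicCenter (B : GL (Fin N) E) {a : E} (ha : a ≠ 0) {J J' : Matrix (Fin N) (Fin N) E}
    (h : formCongr (c : E →+* E) B (a • J) = J') (u : finAdelicOne F E c) :
    finAdelicCongr F E c B ha h (finAdelicCenter F E c N J' u) = finAdelicCenter F E c N J u := by
  apply Subtype.ext
  apply Units.ext
  rw [coe_finAdelicCongr_apply, Units.val_mul, Units.val_mul, coe_finAdelicCenter, coe_finAdelicCenter, Matrix.mul_smul,
    Matrix.mul_one, Matrix.smul_mul, Units.mul_inv]

omit [NumberField F] in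
/-- the same as monoid homomorphisms `U(1)(𝔸_f) → U(J)(𝔸_f)`. [cite: PlatonovRapinchuk1994, §2.3] [cite: Mok2014, §1 Notation p. 5] -/
theorem finAdelicCongr_comp_finAdelicCenter (B : GL (Fin N) E) {a : E} (ha : a ≠ 0) {J J' : Matrix (Fin N) (Fin N) E}
    (h : formCongr (c : E →+* E) B (a • J) = J') :
    (finAdelicCongr F E c B ha h).toMonoidHom.comp (finAdelicCenter F E c N J') = finAdelicCenter F E c N J :=
  MonoidHom.ext fun u => finAdelicCongr_finAdelicCenter F E c N B ha h u

end Literature.NumberTheory.Automorphic.UnitaryGroup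

end
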